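import Summits.PneNP.PneNP.Theorems.ExpanderLinearGeneratorsPickMatrixFraction

/-!
# PneNP / ExpanderLinearGenerators — the generator regime `m = n²` of the crux: random sparse
`n² × n` matrices, and Krajíček's Problem 19.4.5 for them modulo the crux

Route `PneNP/ExpanderLinearGenerators`, crux stmt-PneNP-11443
(`Summit.PneNP.PneNP.Theses.ExpanderLinearGenerators.LinearGeneratorDepthFregeHard`). The crux is
the UNIVERSAL-expander form of Krajíček's Problem 19.4.5, which itself asks about the linear map
`x ↦ A x` of a sparse `n² × n` matrix `A` over `𝔽₂` — a proof complexity GENERATOR stretching `n`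
bits to `m = n²` bits — and the `τ`-formulas `τ_b(A)` ("`b ∉ Im A`", here `sumEncoding 1 (A ∣ b)`):
are they exponentially hard for `AC⁰`-Frege? Krajíček's Theorem 13.3.1 says that random
`ℓ`-sparse `n² × n` matrices are `(n^{1-δ}, 3ℓ/4)`-boundary expanders for `ℓ ≥ ℓ(δ)`. This file
makes both halves kernel-checked, on top of the fraction form of the tree's derandomised count
(`…ExpanderLinearGeneratorsPickMatrixFraction`: pick functions `f : Fin m × Fin (8k) → Fin n` code
`8k`-sparse matrices, row `i` supported on `{f (i, t)}_t`; if every bracket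
`m · e^{7k} · (7ks/n)^k`, `1 ≤ s ≤ R`, is `≤ q ≤ 1/2` then all but a `2q`-fraction of them are
`(R, 7k)`-cover expanding, hence `(R, 3/4 · 8k)`-boundary expanding for every right-hand side):

* `brackets_generator` — in the generator regime `m = n²`, `R = ⌊n^{1-δ}⌋`, `δ k ≥ 3`, every
  bracket is `≤ e^{7k} (7k)^k / n`;
* `exists_unsolvable_expander_generator` — **Theorem 13.3.1 in the generator regime**
  (unconditional): for `0 < δ`, `k ≥ 1`, `δ k ≥ 3` and all large `n` there is an `8k`-sparse
  system of `n²` equations in `n` unknowns over `𝔽₂`, `(n^{1-δ}, 3/4 · 8k)`-boundary expanding and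
  unsolvable — the hypotheses of the crux are inhabited at `m = n²` (the tree had `m = n + 1`,
  `exists_unsolvable_expander_rpow`, and linear-size graph instances);
* `card_not_coverExpanding_generator_le` — moreover all but an `O_k(1/n)`-fraction of the
  `8k`-sparse `n² × n` pick matrices are such expanders;
* `generatorHard_of_linearGeneratorDepthFregeHard` — **the crux answers Problem 19.4.5 for
  random sparse matrices**: assuming `LinearGeneratorDepthFregeHard`, for `0 < δ < 1`, `δ k ≥ 3`
  and every depth `d` there are `ε > 0` and `N` such that for `n ≥ N`, for all but an
  `O_k(1/n)`-fraction of the pick functions `f : Fin n² × Fin (8k) → Fin n`, for EVERY right-hand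
  side `b` making the system unsolvable (and such `b` exist, `2^n < 2^{n²}`), every depth-`d`
  `textbookFrege` proof of `τ_b(A_f) = ¬ sumEncoding 1 (A_f ∣ b)` has size `≥ 2^{n^ε}`;
  `badFraction_tendsto_zero_of_linearGeneratorDepthFregeHard` is the same as a limit, and
  `generator_content_of_linearGeneratorDepthFregeHard` the pointwise content;
* `exists_three_le_colWeight`, `exists_three_le_colWeight_generator` — `n² × n` instances are
  heavy (some variable in `≥ 3` equations): the generator regime lies in the open core.

In this regime the image `Im A_f` is (w.h.p.) a good code, so by the substitution barrier
`SubstitutionBarrier.imageDistance_card_mul_le` (…SubstitutionBarriers) no consequence-form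
embedding of graph Tseitin reaches these instances: they lie in the open core of the crux
(`linearGeneratorDepthFregeHard_iff_three_le_colWeight`).

References: J. Krajíček, *Proof complexity* (CUP 2019), Thm. 13.3.1, Lemma 19.4.4, Problem 19.4.5
[KrajicekProofComplexity2019]; M. Alekhnovich, E. Ben-Sasson, A. A. Razborov, A. Wigderson, SIAM J.
Comput. 34 (2004), Thm. 5.1 [AlekhnovichEtAl2004].
-/

namespace Summit.PneNP.PneNP.Theorems

set_option linter.dupNamespace false -- `Summit.PneNP.PneNP.…`: summit = sub-problem (D-0017)

namespace RandomExpander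

open Finset Filter Topology
open Literature.Computability.Complexity Literature.Computability.MetaComplexity

/-! ### The generator regime `m = n²` -/

/-- **Brackets in the generator regime.** For `0 < δ`, `k ≥ 1` with `δk ≥ 3` and all large `n`:
`0 < n`, `n < n²`, `7k ⌊n^{1-δ}⌋ ≤ n`, the quantity `q_n = e^{7k} (7k)^k / n` is `≤ 1/4`, and
every bracket `n² · e^{7k} · (7ks/n)^k`, `1 ≤ s ≤ ⌊n^{1-δ}⌋`, is `≤ q_n`
(as `(7ks/n)^k ≤ (7k)^k n^{-δk} ≤ (7k)^k / n³`). [folklore] -/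
theorem brackets_generator {δ : ℝ} (hδ : 0 < δ) {k : ℕ} (hk : 1 ≤ k) (hδk : 3 ≤ δ * k) :
    ∃ N : ℕ, ∀ n : ℕ, N ≤ n → 0 < n ∧ n < n ^ 2 ∧ 7 * k * ⌊(n : ℝ) ^ (1 - δ)⌋₊ ≤ n ∧
      Real.exp (7 * k) * (7 * k : ℝ) ^ k / n ≤ 1 / 4 ∧
      ∀ s ∈ Finset.Icc 1 ⌊(n : ℝ) ^ (1 - δ)⌋₊,
        ((n ^ 2 : ℕ) : ℝ) * Real.exp (7 * k) * ((((7 * k * s : ℕ) : ℝ) / n) ^ k) ≤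
          Real.exp (7 * k) * (7 * k : ℝ) ^ k / n := by
  set A : ℝ := (7 * k : ℝ) ^ k with hA
  have hA0 : 0 ≤ A := by positivity
  refine ⟨max (max 2 ⌈(7 * k : ℝ) ^ (1 / δ)⌉₊) ⌈4 * Real.exp (7 * k) * A⌉₊, fun n hn => ?_⟩
  have hn2 : 2 ≤ n := le_trans (le_max_left _ _ |>.trans' (le_max_left _ _)) hn
  have hn0 : 0 < n := by omega
  have hn' : (0 : ℝ) < n := by exact_mod_cast hn0
  have hn1' : (1 : ℝ) ≤ n := by exact_mod_cast hn0
  have hceil : ⌈(7 * k : ℝ) ^ (1 / δ)⌉₊ ≤ n :=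
    le_trans ((le_max_right _ _).trans (le_max_left _ _)) hn
  have hC : 4 * Real.exp (7 * k) * A ≤ n :=
    (Nat.le_ceil _).trans (by exact_mod_cast (le_max_right _ _).trans hn)
  -- `7k ≤ n^δ`
  have h7k : (7 * k : ℝ) ≤ (n : ℝ) ^ δ := le_rpow_of_ceil_le (by positivity) hδ hceil
  have hfl : (⌊(n : ℝ) ^ (1 - δ)⌋₊ : ℝ) ≤ (n : ℝ) ^ (1 - δ) := Nat.floor_le (by positivity)
  refine ⟨hn0, ?_, ?_, ?_, fun s hs => ?_⟩
  · nlinarith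
  · have h : ((7 * k * ⌊(n : ℝ) ^ (1 - δ)⌋₊ : ℕ) : ℝ) ≤ n := by
      push_cast
      calc (7 * k : ℝ) * ⌊(n : ℝ) ^ (1 - δ)⌋₊ ≤ (n : ℝ) ^ δ * (n : ℝ) ^ (1 - δ) := by gcongr
        _ = n := by rw [← Real.rpow_add hn']; norm_num
    exact_mod_cast h
  · rw [div_le_iff₀ hn']
    linarith
  · have hs1 : (s : ℝ) ≤ (n : ℝ) ^ (1 - δ) :=
      le_trans (by exact_mod_cast (Finset.mem_Icc.1 hs).2) hfl
    -- `(7ks/n)^k ≤ (7k)^k · n^{-δk} ≤ (7k)^k / n³`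
    have hfrac : ((7 * k * s : ℕ) : ℝ) / n ≤ 7 * k * (n : ℝ) ^ (-δ) := by
      push_cast
      rw [mul_div_assoc]
      gcongr
      rw [div_le_iff₀ hn', show -δ = (1 - δ) - 1 by ring, Real.rpow_sub_one hn'.ne',
        div_mul_cancel₀ _ hn'.ne']
      exact hs1
    have hP : (((7 * k * s : ℕ) : ℝ) / n) ^ k ≤ A / (n : ℝ) ^ 3 := by
      calc (((7 * k * s : ℕ) : ℝ) / n) ^ k ≤ (7 * k * (n : ℝ) ^ (-δ)) ^ k := by gcongr
        _ = A * (n : ℝ) ^ (-δ * k) := by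
            rw [mul_pow, hA, Real.rpow_mul_natCast hn'.le]
        _ ≤ A * (n : ℝ) ^ (-3 : ℝ) :=
            mul_le_mul_of_nonneg_left (Real.rpow_le_rpow_of_exponent_le hn1' (by linarith)) hA0
        _ = A / (n : ℝ) ^ 3 := by
            rw [Real.rpow_neg hn'.le, div_eq_mul_inv]
            norm_num
    calc ((n ^ 2 : ℕ) : ℝ) * Real.exp (7 * k) * ((((7 * k * s : ℕ) : ℝ) / n) ^ k)
        ≤ ((n ^ 2 : ℕ) : ℝ) * Real.exp (7 * k) * (A / (n : ℝ) ^ 3) := by gcongr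
      _ = Real.exp (7 * k) * A / n := by
          push_cast
          field_simp
      _ = Real.exp (7 * k) * (7 * k : ℝ) ^ k / n := by rw [hA]

/-- **Sparse unsolvable boundary expanders with `n²` rows (Krajíček's Theorem 13.3.1 in the
GENERATOR regime of Problem 19.4.5).** For `0 < δ`, `k ≥ 1` with `δk ≥ 3` and all sufficiently
large `n` there is a system of `n²` linear equations over `𝔽₂` in `n` unknowns with row supports of
size `≤ 8k` forming an `(n^{1-δ}, 3/4 · 8k)`-boundary expander, and with no solution: the
hypotheses of `LinearGeneratorDepthFregeHard` are inhabited by `n² × n` systems, i.e. by the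
`τ`-formulas of an `n ↦ n²` linear generator. [cite: KrajicekProofComplexity2019, Theorem 13.3.1] -/
theorem exists_unsolvable_expander_generator {δ : ℝ} (hδ : 0 < δ) {k : ℕ} (hk : 1 ≤ k)
    (hδk : 3 ≤ δ * k) :
    ∃ N : ℕ, ∀ n : ℕ, N ≤ n → ∃ E : Fin (n ^ 2) → LinEqMod 2 n,
      (∀ i, (E i).supp.card ≤ 8 * k) ∧
      IsBoundaryExpander (fun i => (E i).supp.map Fin.valEmbedding) ((n : ℝ) ^ (1 - δ))
        (3 / 4 * ((8 * k : ℕ) : ℝ)) ∧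
      ¬ SystemSat E Finset.univ := by
  obtain ⟨N, hN⟩ := brackets_generator hδ hk hδk
  refine ⟨N, fun n hn => ?_⟩
  obtain ⟨hn0, hnn, hR, hq4, hq⟩ := hN n hn
  obtain ⟨f, hf⟩ := exists_coverExpanding_of_brackets k (n ^ 2) n _ hn0 hR (by positivity)
    (by linarith) hq
  obtain ⟨E, hsp, hexp, hunsat⟩ := exists_system_of_picks_gen hnn f hf
  exact ⟨E, hsp, isBoundaryExpander_of_floor _ hexp, hunsat⟩

/-- **Most sparse `n² × n` pick matrices are boundary expanders.** For `0 < δ`, `k ≥ 1` with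
`δk ≥ 3` and all large `n`, the pick functions `f : Fin n² × Fin (8k) → Fin n` that are NOT
`(⌊n^{1-δ}⌋, 7k)`-cover expanding number at most `(2 e^{7k} (7k)^k / n) · n^{8k·n²}` — an
`O_k(1/n)`-fraction of all `n^{8k·n²}` pick functions. [cite: KrajicekProofComplexity2019,
Theorem 13.3.1] -/
theorem card_not_coverExpanding_generator_le {δ : ℝ} (hδ : 0 < δ) {k : ℕ} (hk : 1 ≤ k)
    (hδk : 3 ≤ δ * k) :
    ∃ N : ℕ, ∀ n : ℕ, N ≤ n →
      ((Finset.univ.filter fun f : Fin (n ^ 2) × Fin (8 * k) → Fin n =>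
        ¬ ∀ F : Finset (Fin (n ^ 2)), F.Nonempty → F.card ≤ ⌊(n : ℝ) ^ (1 - δ)⌋₊ →
          7 * k * F.card < (F.biUnion fun i => Finset.univ.image fun t => f (i, t)).card).card : ℝ)
      ≤ 2 * (Real.exp (7 * k) * (7 * k : ℝ) ^ k / n) * (n : ℝ) ^ (n ^ 2 * (8 * k)) := by
  obtain ⟨N, hN⟩ := brackets_generator hδ hk hδk
  refine ⟨N, fun n hn => ?_⟩
  obtain ⟨hn0, -, hR, hq4, hq⟩ := hN n hn
  have hq' : ∀ s ∈ Finset.Icc 1 ⌊(n : ℝ) ^ (1 - δ)⌋₊,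
      (((n ^ 2 : ℕ) : ℕ) : ℝ) * Real.exp (7 * k) * ((((7 * k * s : ℕ) : ℝ) / n) ^ k) ≤
        Real.exp (7 * k) * (7 * k : ℝ) ^ k / n := hq
  exact card_not_coverExpanding_le k (n ^ 2) n _ hn0 hR (by positivity) (by linarith) hq'

/-! ### Problem 19.4.5 for random sparse matrices, modulo the crux -/

open Summit.PneNP.PneNP.Theses.ExpanderLinearGenerators

open scoped Classical in
/-- **The crux answers Krajíček's Problem 19.4.5 for random sparse matrices.** Assume
`LinearGeneratorDepthFregeHard`. For `0 < δ < 1`, `k ≥ 1` with `δk ≥ 3` and every depth `d` there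
are `ε > 0` and `N` such that for every `n ≥ N`: the pick functions
`f : Fin n² × Fin (8k) → Fin n` whose `8k`-sparse `n² × n` matrix `A_f` (row `i` the indicator of
`{f (i, t)}_t`) FAILS the conclusion "for every right-hand side `b` with `(A_f ∣ b)` unsolvable,
every depth-`d` `textbookFrege` proof of `¬ sumEncoding 1 (A_f ∣ b)` has size `≥ 2^{n^ε}`" number
at most `(2 e^{7k} (7k)^k / n) · n^{8k·n²}`, an `O_k(1/n)`-fraction of all of them. (For each `f`
unsolvable `b` exist since `2^n < 2^{n²}`, `exists_rhs_not_systemSat`.) That is: modulo the crux,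
the linear map of almost every sparse `n² × n` matrix is an exponentially hard proof complexity
generator for `AC⁰`-Frege, for ALL strings outside its range.
[cite: KrajicekProofComplexity2019, Problem 19.4.5; Theorem 13.3.1; Lemma 19.4.4] -/
theorem generatorHard_of_linearGeneratorDepthFregeHard (h : LinearGeneratorDepthFregeHard)
    {δ : ℝ} (hδ : 0 < δ) (hδ1 : δ < 1) {k : ℕ} (hk : 1 ≤ k) (hδk : 3 ≤ δ * k) (d : ℕ) :
    ∃ ε : ℝ, 0 < ε ∧ ∃ N : ℕ, ∀ n : ℕ, N ≤ n →
      ((Finset.univ.filter fun f : Fin (n ^ 2) × Fin (8 * k) → Fin n =>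
        ¬ ∀ b : Fin (n ^ 2) → ZMod 2,
          ¬ SystemSat (fun i => ((fun j => if j ∈ (Finset.univ.image fun t => f (i, t))
              then (1 : ZMod 2) else 0), b i)) Finset.univ →
          ∀ π : List (PropForm ℕ), textbookFrege.IsDepthProofOf d π
            (PropForm.neg (PropForm.ofCNF (sumEncoding 1
              (fun i => ((fun j => if j ∈ (Finset.univ.image fun t => f (i, t))
                then (1 : ZMod 2) else 0), b i))))) →
            (2 : ℝ) ^ ((n : ℝ) ^ ε) ≤ (proofSize π : ℝ)).card : ℝ)
      ≤ 2 * (Real.exp (7 * k) * (7 * k : ℝ) ^ k / n) * (n : ℝ) ^ (n ^ 2 * (8 * k)) := by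
  classical
  obtain ⟨ε, hε, N₁, hN₁⟩ := h (8 * k) d δ (by omega) hδ hδ1
  obtain ⟨N₂, hN₂⟩ := brackets_generator hδ hk hδk
  refine ⟨ε, hε, max N₁ N₂, fun n hn => ?_⟩
  obtain ⟨hn0, -, hR, hq4, hq⟩ := hN₂ n ((le_max_right _ _).trans hn)
  have hq' : ∀ s ∈ Finset.Icc 1 ⌊(n : ℝ) ^ (1 - δ)⌋₊,
      (((n ^ 2 : ℕ) : ℕ) : ℝ) * Real.exp (7 * k) * ((((7 * k * s : ℕ) : ℝ) / n) ^ k) ≤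
        Real.exp (7 * k) * (7 * k : ℝ) ^ k / n := hq
  refine le_trans ?_ (card_not_coverExpanding_le k (n ^ 2) n _ hn0 hR (by positivity)
    (by linarith) hq')
  -- a cover-expanding `f` satisfies the conclusion, by the crux
  refine Nat.cast_le.2 (Finset.card_le_card fun f hf => ?_)
  rw [Finset.mem_filter] at hf ⊢
  refine ⟨hf.1, fun hce => hf.2 fun b hunsat π hπ => ?_⟩
  obtain ⟨hsp, hexp⟩ := hyps_of_picks f hce
    (fun i => ((fun j => if j ∈ (Finset.univ.image fun t => f (i, t)) then (1 : ZMod 2) else 0),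
      b i)) (fun i => rfl)
  exact hN₁ n ((le_max_left _ _).trans hn) (n ^ 2) _ hsp (isBoundaryExpander_of_floor _ hexp)
    hunsat π hπ

open scoped Classical in
/-- **The same as a limit: the bad fraction tends to `0`.** Under `LinearGeneratorDepthFregeHard`,
for `0 < δ < 1`, `δk ≥ 3`, `k ≥ 1` and every depth `d` there is `ε > 0` such that the FRACTION of
pick functions `f : Fin n² × Fin (8k) → Fin n` failing "every unsolvable `τ_b(A_f)` needs depth-`d`
`textbookFrege` proofs of size `≥ 2^{n^ε}`" tends to `0` as `n → ∞`.
[cite: KrajicekProofComplexity2019, Problem 19.4.5; Theorem 13.3.1] -/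
theorem badFraction_tendsto_zero_of_linearGeneratorDepthFregeHard
    (h : LinearGeneratorDepthFregeHard) {δ : ℝ} (hδ : 0 < δ) (hδ1 : δ < 1) {k : ℕ} (hk : 1 ≤ k)
    (hδk : 3 ≤ δ * k) (d : ℕ) :
    ∃ ε : ℝ, 0 < ε ∧ Tendsto (fun n : ℕ =>
      ((Finset.univ.filter fun f : Fin (n ^ 2) × Fin (8 * k) → Fin n =>
        ¬ ∀ b : Fin (n ^ 2) → ZMod 2,
          ¬ SystemSat (fun i => ((fun j => if j ∈ (Finset.univ.image fun t => f (i, t))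
              then (1 : ZMod 2) else 0), b i)) Finset.univ →
          ∀ π : List (PropForm ℕ), textbookFrege.IsDepthProofOf d π
            (PropForm.neg (PropForm.ofCNF (sumEncoding 1
              (fun i => ((fun j => if j ∈ (Finset.univ.image fun t => f (i, t))
                then (1 : ZMod 2) else 0), b i))))) →
            (2 : ℝ) ^ ((n : ℝ) ^ ε) ≤ (proofSize π : ℝ)).card : ℝ) /
        (Fintype.card (Fin (n ^ 2) × Fin (8 * k) → Fin n) : ℝ)) atTop (𝓝 0) := by
  classical
  obtain ⟨ε, hε, N, hN⟩ := generatorHard_of_linearGeneratorDepthFregeHard h hδ hδ1 hk hδk d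
  refine ⟨ε, hε, ?_⟩
  have htot : ∀ n : ℕ, (Fintype.card (Fin (n ^ 2) × Fin (8 * k) → Fin n) : ℝ)
      = (n : ℝ) ^ (n ^ 2 * (8 * k)) := by
    intro n
    rw [Fintype.card_fun, Fintype.card_prod, Fintype.card_fin, Fintype.card_fin,
      Fintype.card_fin]
    push_cast
    ring
  have hlim : Tendsto (fun n : ℕ => 2 * (Real.exp (7 * k) * (7 * k : ℝ) ^ k) / (n : ℝ))
      atTop (𝓝 0) := tendsto_const_div_atTop_nhds_zero_nat _
  refine tendsto_of_tendsto_of_tendsto_of_le_of_le' tendsto_const_nhds hlim ?_ ?_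
  · exact Eventually.of_forall fun n => by positivity
  · rw [eventually_atTop]
    refine ⟨max N 1, fun n hn => ?_⟩
    have hn1 : 1 ≤ n := (le_max_right _ _).trans hn
    have hn' : (0 : ℝ) < n := by exact_mod_cast hn1
    have hpos : (0 : ℝ) < (n : ℝ) ^ (n ^ 2 * (8 * k)) := pow_pos hn' _
    rw [htot, div_le_iff₀ hpos]
    calc _ ≤ 2 * (Real.exp (7 * k) * (7 * k : ℝ) ^ k / n) * (n : ℝ) ^ (n ^ 2 * (8 * k)) :=
          hN n ((le_max_left _ _).trans hn)
      _ = 2 * (Real.exp (7 * k) * (7 * k : ℝ) ^ k) / (n : ℝ) * (n : ℝ) ^ (n ^ 2 * (8 * k)) := by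
          ring

/-- **The pointwise content in the generator regime.** Under `LinearGeneratorDepthFregeHard`, for
`0 < δ < 1`, `k ≥ 1`, `δk ≥ 3` and every depth `d` there are `ε > 0` and `N` such that for every
`n ≥ N` there is an `8k`-sparse `(n^{1-δ}, 3/4·8k)`-boundary-expanding unsolvable system of `n²`
equations in `n` unknowns over `𝔽₂`, and EVERY such system — in particular every unsolvable
`τ_b(A)` of every such matrix — has only depth-`d` `textbookFrege` refutations of size
`≥ 2^{n^ε}`. [cite: KrajicekProofComplexity2019, Problem 19.4.5; Theorem 13.3.1] -/
theorem generator_content_of_linearGeneratorDepthFregeHard (h : LinearGeneratorDepthFregeHard)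
    {δ : ℝ} (hδ : 0 < δ) (hδ1 : δ < 1) {k : ℕ} (hk : 1 ≤ k) (hδk : 3 ≤ δ * k) (d : ℕ) :
    ∃ ε : ℝ, 0 < ε ∧ ∃ N : ℕ, ∀ n : ℕ, N ≤ n →
      (∃ E : Fin (n ^ 2) → LinEqMod 2 n,
        (∀ i, (E i).supp.card ≤ 8 * k) ∧
        IsBoundaryExpander (fun i => (E i).supp.map Fin.valEmbedding) ((n : ℝ) ^ (1 - δ))
          (3 / 4 * ((8 * k : ℕ) : ℝ)) ∧
        ¬ SystemSat E Finset.univ) ∧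
      ∀ E : Fin (n ^ 2) → LinEqMod 2 n,
        (∀ i, (E i).supp.card ≤ 8 * k) →
        IsBoundaryExpander (fun i => (E i).supp.map Fin.valEmbedding) ((n : ℝ) ^ (1 - δ))
          (3 / 4 * ((8 * k : ℕ) : ℝ)) →
        ¬ SystemSat E Finset.univ →
        ∀ π : List (PropForm ℕ), textbookFrege.IsDepthProofOf d π
          (PropForm.neg (PropForm.ofCNF (sumEncoding 1 E))) →
          (2 : ℝ) ^ ((n : ℝ) ^ ε) ≤ (proofSize π : ℝ) := by
  obtain ⟨ε, hε, N₁, hN₁⟩ := h (8 * k) d δ (by omega) hδ hδ1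
  obtain ⟨N₂, hN₂⟩ := exists_unsolvable_expander_generator hδ hk hδk
  refine ⟨ε, hε, max N₁ N₂, fun n hn => ⟨hN₂ n ((le_max_right _ _).trans hn), ?_⟩⟩
  intro E hsp hexp hunsat π hπ
  have := hN₁ n ((le_max_left _ _).trans hn) (n ^ 2) E hsp (by push_cast at hexp ⊢; exact hexp)
    hunsat π hπ
  exact this


/-! ### The generator regime lies in the heavy (open) case of the crux -/

/-- **Many equations force a heavy variable.** If every equation has nonempty support and there
are more than `2n` equations in `n` unknowns, some variable lies in the support of at least three
equations (double counting of incidences). [folklore] -/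
theorem exists_three_le_colWeight {m n : ℕ} (E : Fin m → LinEqMod 2 n)
    (hne : ∀ i, (E i).supp.Nonempty) (hm : 2 * n < m) :
    ∃ j : Fin n, 3 ≤ (Finset.univ.filter fun i => j ∈ (E i).supp).card := by
  by_contra h
  push Not at h
  have h1 : ∑ j : Fin n, (Finset.univ.filter fun i => j ∈ (E i).supp).card ≤ 2 * n := by
    calc _ ≤ ∑ _j : Fin n, 2 := Finset.sum_le_sum fun j _ => Nat.lt_succ_iff.1 (h j)
      _ = 2 * n := by simp [mul_comm]
  have h2 : ∑ j : Fin n, (Finset.univ.filter fun i => j ∈ (E i).supp).card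
      = ∑ i : Fin m, (E i).supp.card := by
    simp only [Finset.card_filter]
    rw [Finset.sum_comm]
    refine Finset.sum_congr rfl fun i _ => ?_
    rw [Finset.sum_ite_mem, Finset.univ_inter, Finset.sum_const, smul_eq_mul, mul_one]
  have h3 : m ≤ ∑ i : Fin m, (E i).supp.card := by
    calc m = ∑ _i : Fin m, 1 := by simp
      _ ≤ _ := Finset.sum_le_sum fun i _ => Finset.card_pos.2 (hne i)
  omega

/-- **The `n² × n` instances of the crux are heavy.** For `n ≥ 3`, every system of `n²`
equations in `n` unknowns whose supports form an `(n^{1-δ}, 3/4 · 8k)`-boundary expander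
(`k ≥ 1`, `δ ≤ 1`) has a variable in at least three equations — so the generator regime lies in
the column-weight-`≥ 3` case of the crux, which is exactly its open core
(`linearGeneratorDepthFregeHard_iff_three_le_colWeight`; the column-weight-`≤ 2` case is the
theorem `ColumnTwo.linearGeneratorDepthFregeHard_of_colWeight_le_two`). [folklore] -/
theorem exists_three_le_colWeight_generator {n k : ℕ} {δ : ℝ} (hn : 3 ≤ n) (hk : 1 ≤ k)
    (hδ1 : δ ≤ 1) (E : Fin (n ^ 2) → LinEqMod 2 n)
    (hexp : IsBoundaryExpander (fun i => (E i).supp.map Fin.valEmbedding) ((n : ℝ) ^ (1 - δ))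
      (3 / 4 * ((8 * k : ℕ) : ℝ))) :
    ∃ j : Fin n, 3 ≤ (Finset.univ.filter fun i => j ∈ (E i).supp).card := by
  have h2n : 2 * n < n ^ 2 :=
    calc 2 * n < 3 * n := by omega
      _ ≤ n * n := Nat.mul_le_mul_right n hn
      _ = n ^ 2 := (sq n).symm
  refine exists_three_le_colWeight E (fun i => ?_) h2n
  have hk' : (0 : ℝ) < 3 / 4 * ((8 * k : ℕ) : ℝ) := by
    have : (1 : ℝ) ≤ k := by exact_mod_cast hk
    push_cast
    linarith
  have h := hexp.card_pos hk'
    (Real.one_le_rpow (by exact_mod_cast (by omega : 1 ≤ n)) (by linarith)) i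
  rw [Finset.card_map] at h
  exact Finset.card_pos.1 h

end RandomExpander

end Summit.PneNP.PneNP.Theorems
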